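import Literature.Geometry.Lorentzian.KerrSchildMultiplierCurrent
import Literature.Geometry.Lorentzian.MinkowskiRadialMultiplier
import Summits.FinalStateConjecture.FinalStateConjecture.Theorems.ClusterCompletenessAdiabaticMultiKerrILEDHomothetyCurrent
import Summits.FinalStateConjecture.FinalStateConjecture.Theorems.ClusterCompletenessAdiabaticMultiKerrILEDZonePumping

/-! # Route ClusterCompleteness — crux `AdiabaticMultiKerrILED`: zone divergence of the homothety

Helper file for the crux `stmt-FinalStateConjecture-14310` (line `Sketch`, lead c6 wave 2, card
milne-hubble-current): in the rest frame of one Schwarzschild hole (`a = 0`, mass `M`, centre at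
the spatial origin) the tails-cut crux background is `G_χ = η − F`,
`F^{αβ}(y) = χ(r) · 2H · ℓ♯^α ℓ♯^β` (`r = Kerr.radius 0 y`, `H = M/r`, `ℓ♯ = Kerr.nullVector 0 y`,
`χ(r) = Real.smoothTransition (2 − r/(8M))`). Two facts:
* the divergence of the conformally corrected homothety current `J^S + ¼ L₄` of
  `S = (x − x₀)·∂` for `G_χ` (`sum_fderiv_homothetyCurrent` with `∂G_χ = −∂F`): the radial piece
  `½ ∑_{αβ} (x·∂F^{αβ}) ∂_αw ∂_βw` is evaluated by the Euler / null-dust pumping identity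
  `x·∂F = (r χ' − χ) · 2H · ℓ♯ ⊗ ℓ♯` (`fderiv_self_cruxZoneTerm_schwarzschild`) to
  `−(χ − r χ') H (ℓ♯·dw)²`, leaving the `x₀`-moment `−½ ∑_μ x₀^μ ∑_{αβ} ∂_μF^{αβ} ∂_αw ∂_βw`;
* stationarity of the zone term: `∂_{t*} F^{μν} = 0` for all `M, a` (`r`, `H`, `ℓ♯` do not depend
  on `t*`).
[folklore] -/

noncomputable section

-- the doubled `FinalStateConjecture.FinalStateConjecture` path component trips dupNamespace
set_option linter.dupNamespace false

open scoped BigOperators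
open Literature.Geometry.Lorentzian

namespace Summit.FinalStateConjecture.FinalStateConjecture.Theorems

/-- A covector evaluated at `x` expands in coordinates: `φ(x) = ∑_μ x^μ φ(∂_μ)` (linearity and
`x = ∑_μ x^μ ∂_μ`). [folklore] -/
theorem zoneDiv_clm_apply_eq_sum (φ : E4 →L[ℝ] ℝ) (x : E4) :
    φ x = ∑ μ, x μ * φ (E4.basisVector μ) := by
  conv_lhs => rw [Kerr.eq_sum_basisVector x]
  simp only [map_sum, map_smul, smul_eq_mul]

/-- If `F` is invariant along the line `t ↦ x + t v` then `DF(x)[v] = 0`: for `F` differentiable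
at `x` the line derivative is `DF(x)[v]` and the line is mapped to a constant; otherwise
`DF(x) = 0` by convention. [folklore] -/
theorem zoneDiv_fderiv_apply_eq_zero_of_forall_add_smul {F : E4 → ℝ} {x v : E4}
    (h : ∀ t : ℝ, F (x + t • v) = F x) : fderiv ℝ F x v = 0 := by
  by_cases hd : DifferentiableAt ℝ F x
  · have h1 : HasLineDerivAt ℝ F (fderiv ℝ F x v) x v := hd.hasFDerivAt.hasLineDerivAt v
    have h2 : HasLineDerivAt ℝ F 0 x v := by
      have hc : (fun t : ℝ ↦ F (x + t • v)) = fun _ ↦ F x := funext h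
      change HasDerivAt (fun t : ℝ ↦ F (x + t • v)) 0 0
      rw [hc]
      exact hasDerivAt_const (0 : ℝ) (F x)
    exact h1.unique h2
  · rw [fderiv_zero_of_not_differentiableAt hd, zero_apply]

/-- The crux zone term `y ↦ χ(r) · 2H · ℓ♯^μ ℓ♯^ν` is differentiable wherever the Kerr–Schild
radius is positive (`Kerr.contDiffAt_radius`, `Kerr.contDiffAt_scalarH`,
`Kerr.contDiffAt_nullVector`; the cut-off is smooth). [folklore] -/
theorem zoneDiv_differentiableAt_cruxZoneTerm (M a : ℝ) {x : E4} (hx : 0 < Kerr.radius a x)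
    (μ ν : Fin 4) :
    DifferentiableAt ℝ (fun y ↦ Real.smoothTransition (2 - Kerr.radius a y / (8 * M)) *
      (2 * Kerr.scalarH M a y) * (Kerr.nullVector a y) μ * (Kerr.nullVector a y) ν) x := by
  have hrd : DifferentiableAt ℝ (Kerr.radius a) x :=
    (Kerr.contDiffAt_radius hx (n := 1)).differentiableAt one_ne_zero
  have hHd : DifferentiableAt ℝ (Kerr.scalarH M a) x :=
    (Kerr.contDiffAt_scalarH M a hx (n := 1)).differentiableAt one_ne_zero
  have hld : ∀ κ : Fin 4, DifferentiableAt ℝ (fun y ↦ Kerr.nullVector a y κ) x := fun κ ↦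
    ((contDiffAt_euclidean.1 (Kerr.contDiffAt_nullVector a hx (n := 1))) κ).differentiableAt
      one_ne_zero
  have hχd : DifferentiableAt ℝ
      (fun y ↦ Real.smoothTransition (2 - Kerr.radius a y / (8 * M))) x :=
    (zonePumping_differentiable_cutoff M (Kerr.radius a x)).comp x hrd
  exact ((hχd.mul (hHd.const_mul 2)).mul (hld μ)).mul (hld ν)

/-- The Minkowski components `η = diag(−1, 1, 1, 1)` are symmetric. [folklore] -/
theorem zoneDiv_etaComp_symm (μ ν : Fin 4) : Kerr.etaComp μ ν = Kerr.etaComp ν μ := by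
  unfold Kerr.etaComp
  by_cases h : μ = ν
  · subst h
    rfl
  · rw [if_neg h, if_neg (Ne.symm h)]

/-- **The homothety divergence for a Kerr–Schild-type background `G = η − F`.** For `F`
differentiable and symmetric at `x` and `w` of class `C²` at `x`,
`∑_μ ∂_μ (J^S + ¼ L₄)^μ = (S(w) + w) □_G w + ½ ∑_{αβ} (x·∂F^{αβ}) ∂_αw ∂_βw
  − ½ ∑_μ x₀^μ ∑_{αβ} ∂_μF^{αβ} ∂_αw ∂_βw`:
`sum_fderiv_homothetyCurrent` with `∂_μ G = −∂_μ F` (`η` is constant), the factor `x^μ − x₀^μ`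
split, and `∑_μ x^μ ∂_μF = DF(x)[x]` (`zoneDiv_clm_apply_eq_sum`). [folklore] -/
theorem zoneDiv_sum_fderiv_homothetyCurrent_eta_sub (F : E4 → Fin 4 → Fin 4 → ℝ) (x₀ : E4)
    (w : E4 → ℝ) (x : E4) (hF : ∀ μ ν, DifferentiableAt ℝ (fun y ↦ F y μ ν) x)
    (hsymm : ∀ μ ν, F x μ ν = F x ν μ) (hw : ContDiffAt ℝ 2 w x) :
    ∑ μ, fderiv ℝ (fun y ↦ KerrSchild.multiplierCurrent (fun z α β ↦ Kerr.etaComp α β - F z α β)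
        (fun z α ↦ z α - x₀ α) w y μ +
      4⁻¹ * KerrSchild.lagrangianCurrent (fun z α β ↦ Kerr.etaComp α β - F z α β)
        (fun _ ↦ (4 : ℝ)) w y μ) x (E4.basisVector μ) =
      ((∑ α, (x α - x₀ α) * fderiv ℝ w x (E4.basisVector α)) + w x) *
          KerrSchild.waveOperator (fun z α β ↦ Kerr.etaComp α β - F z α β) w x +
        2⁻¹ * ∑ α, ∑ β, fderiv ℝ (fun y ↦ F y α β) x x *
          fderiv ℝ w x (E4.basisVector α) * fderiv ℝ w x (E4.basisVector β) -
        2⁻¹ * ∑ μ, x₀ μ * ∑ α, ∑ β, fderiv ℝ (fun y ↦ F y α β) x (E4.basisVector μ) *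
          fderiv ℝ w x (E4.basisVector α) * fderiv ℝ w x (E4.basisVector β) := by
  have hG : ∀ μ ν, DifferentiableAt ℝ
      (fun y ↦ (fun (z : E4) (α β : Fin 4) ↦ Kerr.etaComp α β - F z α β) y μ ν) x :=
    fun μ ν ↦ (hF μ ν).const_sub (Kerr.etaComp μ ν)
  have hGsymm : ∀ μ ν, (fun (z : E4) (α β : Fin 4) ↦ Kerr.etaComp α β - F z α β) x μ ν =
      (fun (z : E4) (α β : Fin 4) ↦ Kerr.etaComp α β - F z α β) x ν μ := by
    intro μ ν
    change Kerr.etaComp μ ν - F x μ ν = Kerr.etaComp ν μ - F x ν μ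
    rw [zoneDiv_etaComp_symm, hsymm]
  rw [sum_fderiv_homothetyCurrent _ x₀ w x hG hGsymm hw]
  -- `∂_μ (η − F) = −∂_μ F` and `DF(x)[x] = ∑_μ x^μ ∂_μ F`
  have hdG : ∀ μ α β, fderiv ℝ (fun y ↦ Kerr.etaComp α β - F y α β) x (E4.basisVector μ) =
      -fderiv ℝ (fun y ↦ F y α β) x (E4.basisVector μ) := by
    intro μ α β
    rw [fderiv_const_sub, neg_apply]
  have hrad : ∀ α β, fderiv ℝ (fun y ↦ F y α β) x x =
      ∑ μ, x μ * fderiv ℝ (fun y ↦ F y α β) x (E4.basisVector μ) :=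
    fun α β ↦ zoneDiv_clm_apply_eq_sum _ x
  simp only [hdG, hrad]
  -- name the atoms and expand the finite sums
  obtain ⟨P, hP⟩ : ∃ P : Fin 4 → ℝ, ∀ β, fderiv ℝ w x (E4.basisVector β) = P β :=
    ⟨_, fun _ ↦ rfl⟩
  obtain ⟨dF, hdF⟩ : ∃ dF : Fin 4 → Fin 4 → Fin 4 → ℝ, ∀ μ α β,
      fderiv ℝ (fun y ↦ F y α β) x (E4.basisVector μ) = dF μ α β := ⟨_, fun _ _ _ ↦ rfl⟩
  simp only [hP, hdF]
  simp only [Fin.sum_univ_four, Fin.isValue]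
  ring

/-- **The homothety divergence on the tails-cut Schwarzschild zone.** For the crux background
`G_χ = η − F`, `F^{αβ} = χ(r) · 2H · ℓ♯^α ℓ♯^β` (`a = 0`, centre at the origin), at a point off the
axis `{x⃗ = 0}` and for `w` of class `C²` there,
`∑_μ ∂_μ (J^S + ¼ L₄)^μ = (S(w) + w) □_{G_χ} w − (χ − r χ') H (ℓ♯·dw)²
  − ½ ∑_μ x₀^μ ∑_{αβ} ∂_μF^{αβ} ∂_αw ∂_βw`:
`zoneDiv_sum_fderiv_homothetyCurrent_eta_sub` and the pumping identity
`x·∂F^{αβ} = (r χ' − χ) · 2H · ℓ♯^α ℓ♯^β` (`fderiv_self_cruxZoneTerm_schwarzschild`), with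
`∑_{αβ} ℓ♯^α ℓ♯^β ∂_αw ∂_βw = (ℓ♯·dw)²`. [folklore] -/
theorem sum_fderiv_homothetyCurrent_cruxZone_schwarzschild :
    ∀ (M : ℝ) (x₀ : E4) (w : E4 → ℝ) (x : E4) (hx : 0 < E4.spatialNorm x)
      (hw : ContDiffAt ℝ 2 w x),
      ∑ μ, fderiv ℝ (fun y ↦ KerrSchild.multiplierCurrent
          (fun z α β ↦ Kerr.etaComp α β - Real.smoothTransition (2 - Kerr.radius 0 z / (8 * M)) *
            (2 * Kerr.scalarH M 0 z) * (Kerr.nullVector 0 z) α * (Kerr.nullVector 0 z) β)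
          (fun z α ↦ z α - x₀ α) w y μ +
        4⁻¹ * KerrSchild.lagrangianCurrent
          (fun z α β ↦ Kerr.etaComp α β - Real.smoothTransition (2 - Kerr.radius 0 z / (8 * M)) *
            (2 * Kerr.scalarH M 0 z) * (Kerr.nullVector 0 z) α * (Kerr.nullVector 0 z) β)
          (fun _ ↦ (4 : ℝ)) w y μ) x (E4.basisVector μ) =
        ((∑ α, (x α - x₀ α) * fderiv ℝ w x (E4.basisVector α)) + w x) *
            KerrSchild.waveOperator
              (fun z α β ↦ Kerr.etaComp α β -
                Real.smoothTransition (2 - Kerr.radius 0 z / (8 * M)) *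
                  (2 * Kerr.scalarH M 0 z) * (Kerr.nullVector 0 z) α * (Kerr.nullVector 0 z) β)
              w x -
          (Real.smoothTransition (2 - Kerr.radius 0 x / (8 * M)) -
              Kerr.radius 0 x *
                deriv (fun s ↦ Real.smoothTransition (2 - s / (8 * M))) (Kerr.radius 0 x)) *
            Kerr.scalarH M 0 x *
              (∑ α, (Kerr.nullVector 0 x) α * fderiv ℝ w x (E4.basisVector α)) ^ 2 -
          2⁻¹ * ∑ μ, x₀ μ * ∑ α, ∑ β, fderiv ℝ (fun y ↦
              Real.smoothTransition (2 - Kerr.radius 0 y / (8 * M)) * (2 * Kerr.scalarH M 0 y) *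
                (Kerr.nullVector 0 y) α * (Kerr.nullVector 0 y) β) x (E4.basisVector μ) *
            fderiv ℝ w x (E4.basisVector α) * fderiv ℝ w x (E4.basisVector β) := by
  intro M x₀ w x hx hw
  have hx0 : 0 < Kerr.radius 0 x := by rwa [Kerr.radius_zero_left]
  have hF : ∀ μ ν, DifferentiableAt ℝ (fun y ↦
      Real.smoothTransition (2 - Kerr.radius 0 y / (8 * M)) * (2 * Kerr.scalarH M 0 y) *
        (Kerr.nullVector 0 y) μ * (Kerr.nullVector 0 y) ν) x :=
    fun μ ν ↦ zoneDiv_differentiableAt_cruxZoneTerm M 0 hx0 μ ν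
  have hsymm : ∀ μ ν,
      Real.smoothTransition (2 - Kerr.radius 0 x / (8 * M)) * (2 * Kerr.scalarH M 0 x) *
          (Kerr.nullVector 0 x) μ * (Kerr.nullVector 0 x) ν =
        Real.smoothTransition (2 - Kerr.radius 0 x / (8 * M)) * (2 * Kerr.scalarH M 0 x) *
          (Kerr.nullVector 0 x) ν * (Kerr.nullVector 0 x) μ := fun μ ν ↦ by ring
  rw [zoneDiv_sum_fderiv_homothetyCurrent_eta_sub (fun (z : E4) (α β : Fin 4) ↦
    Real.smoothTransition (2 - Kerr.radius 0 z / (8 * M)) * (2 * Kerr.scalarH M 0 z) *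
      (Kerr.nullVector 0 z) α * (Kerr.nullVector 0 z) β) x₀ w x hF hsymm hw]
  beta_reduce
  simp only [fderiv_self_cruxZoneTerm_schwarzschild M x hx]
  -- name the atoms and expand the finite sums
  obtain ⟨P, hP⟩ : ∃ P : Fin 4 → ℝ, ∀ β, fderiv ℝ w x (E4.basisVector β) = P β :=
    ⟨_, fun _ ↦ rfl⟩
  obtain ⟨dF, hdF⟩ : ∃ dF : Fin 4 → Fin 4 → Fin 4 → ℝ, ∀ μ α β,
      fderiv ℝ (fun y ↦ Real.smoothTransition (2 - Kerr.radius 0 y / (8 * M)) *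
        (2 * Kerr.scalarH M 0 y) * (Kerr.nullVector 0 y) α * (Kerr.nullVector 0 y) β) x
        (E4.basisVector μ) = dF μ α β := ⟨_, fun _ _ _ ↦ rfl⟩
  simp only [hP, hdF]
  simp only [Fin.sum_univ_four, Fin.isValue]
  ring

/-- **Stationarity of the crux zone term**: `∂_{t*} (χ(r) · 2H · ℓ♯^μ ℓ♯^ν) = 0` at every point
and for all `M, a`, since `r`, `H`, `ℓ♯` are invariant under `t*`-translations
(`Kerr.radius_add_time_smul_basisVector`, `Kerr.scalarH_add_smul_basisVector_zero`,
`Kerr.nullVector_add_smul_basisVector_zero`): the zone term is constant along `t ↦ x + t ∂_{t*}`,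
so its derivative in the direction `∂_{t*}` vanishes (where it is not differentiable the
derivative is `0` by convention). [folklore] -/
theorem fderiv_cruxZoneTerm_basisVector_zero :
    ∀ (M a : ℝ) (x : E4) (μ ν : Fin 4), fderiv ℝ (fun y ↦
      Real.smoothTransition (2 - Kerr.radius a y / (8 * M)) * (2 * Kerr.scalarH M a y) *
        (Kerr.nullVector a y) μ * (Kerr.nullVector a y) ν) x (E4.basisVector 0) = 0 := by
  intro M a x μ ν
  refine zoneDiv_fderiv_apply_eq_zero_of_forall_add_smul fun t ↦ ?_
  beta_reduce
  rw [Kerr.radius_add_time_smul_basisVector, Kerr.scalarH_add_smul_basisVector_zero,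
    Kerr.nullVector_add_smul_basisVector_zero]

end Summit.FinalStateConjecture.FinalStateConjecture.Theorems
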